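import Summits.QuantumFields.QCD.Theses.NestedDissectionSea

/-!
# Crux `CoerciveSea` (stmt-QuantumFields-13901), line `chirality-collapses-pseudospectrum` —
# DYADIC SHELLS: a sheet-weighted pile-up is a heavy shell (or an exact zero mode seen by the separator)

Helper file of the kept line lead (c1). The open laws of the line (`stub_chiralPileupRareLarge`,
`stub_achiralPileupRareLarge`, skeleton v5-c1) bound the phase-quenched probability of a PILE-UP event: a family of
pencil eigenvectors `u_j` (`D_c u_j = ev_j Γ_c u_j`) with `|ev_j| < 2τ`, weights `0 ≤ wgt_j`, `wgt_j |ev_j| ≤ 1`, and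
`Σ_j wgt_j f_j > 1/(4τ)`, `f_j = Σ_{p ∈ Σ} ‖u_j p‖²` the sheet fraction. Lead-0's finding L1 shows these must be TAIL
laws (first moments of the pile-up diverge logarithmically as soon as the sheet-weighted density of states is positive
at `0`). This file lands the deterministic first step of any such tail bound — the conversion of the weighted sum into
COUNTS at geometric scales (pure bookkeeping on `(ev, wgt, f)`; no matrix, no measure):

* `dyadic_of_weighted_sum` — for reals `0 ≤ x_j < 2τ`, `w_j x_j ≤ 1`, `0 ≤ f_j` with `f_j = 0` whenever
  `x_j = 0`: if `Σ_j w_j f_j > 1/(4τ)` then SOME SHELL IS HEAVY: `∃ i, Σ_{j : x_j < 2τ/4^i} f_j > 1/(16·8^i)`.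
  (If every shell were light, `w_j ≤ 1/x_j ≤ (2/τ) Σ_{i : x_j < 2τ/4^i} 4^i` and swapping the sums gives
  `Σ w f ≤ (2/τ) Σ_i 4^i/(16·8^i) ≤ 1/(4τ)`.) In the scale `σ_i = 2τ/4^i` the threshold reads `(1/16)(σ_i/2τ)^{3/2}`.
* `dyadicShell_of_pileup` (registered stub of the crux item) — the crux-shaped form: a pile-up family at level `τ`
  with threshold `1/(4τ)` (the A″/B″ threshold) has EITHER an exact zero mode with positive sheet fraction (a crossing
  of the cell at the very valence mass, visible on the separator — the `i = ∞` shell) OR a heavy shell `i`: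
  the sheet-weighted count of the family members with `|ev_j| < 2τ/4^i` exceeds `1/(16·8^i)`.

So each law is implied by a summable family of Wegner/Minami-type shell bounds
`P(sheet-weighted count below 2τ4^{−i} > 8^{−i}/16) ≤ C_i t^α` with `Σ_i C_i < ∞`, plus the negligibility of exact
crossings at the valence mass. [folklore]
-/

noncomputable section

open scoped BigOperators
open Literature.MathematicalPhysics.QuantumLattice Literature.MathematicalPhysics.QuantumFieldTheory
  Literature.Probability.LatticeModels

namespace Summit.QuantumFields.QCD.Cruxes.CoerciveSea.ChiralityCollapsesPseudospectrum

/-- **Heavy shell from a weighted sum.** Reals `0 ≤ x_j < 2τ` (levels), `w_j` with `w_j x_j ≤ 1` (weights),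
`0 ≤ f_j` with `f_j = 0` whenever `x_j = 0` (marks): a weighted sum `Σ_j w_j f_j > 1/(4τ)` forces a shell `i` whose
mark count `Σ_{j : x_j < 2τ/4^i} f_j` exceeds `1/(16·8^i)`. [folklore] -/
theorem dyadic_of_weighted_sum {ι : Type*} [Fintype ι] (x w f : ι → ℝ) (τ : ℝ) (hτ : 0 < τ)
    (hf : ∀ j, 0 ≤ f j) (hx : ∀ j, 0 ≤ x j) (hxτ : ∀ j, x j < 2 * τ)
    (hwx : ∀ j, w j * x j ≤ 1) (hzero : ∀ j, x j = 0 → f j = 0)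
    (hpile : 1 / (4 * τ) < ∑ j, w j * f j) :
    ∃ i : ℕ, 1 / (16 * 8 ^ i) < ∑ j, if x j < 2 * τ / 4 ^ i then f j else 0 := by
  classical
  by_contra hcon
  push Not at hcon
  -- Step 1: a common depth `I` strictly below every positive level
  have hIj : ∀ j, ∃ I : ℕ, 0 < x j → 2 * τ / 4 ^ I < x j := by
    intro j
    by_cases hj : 0 < x j
    · obtain ⟨n, hn⟩ := pow_unbounded_of_one_lt (2 * τ / x j) (by norm_num : (1 : ℝ) < 4)
      refine ⟨n, fun _ => ?_⟩
      rw [div_lt_iff₀ (by positivity)]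
      rw [div_lt_iff₀ hj] at hn
      linarith
    · exact ⟨0, fun h => absurd h hj⟩
  choose Ij hIj using hIj
  obtain ⟨I, hI⟩ : ∃ I : ℕ, ∀ j, 0 < x j → 2 * τ / 4 ^ I < x j := by
    refine ⟨Finset.univ.sup Ij, fun j hj => lt_of_le_of_lt ?_ (hIj j hj)⟩
    have hle : Ij j ≤ Finset.univ.sup Ij := Finset.le_sup (Finset.mem_univ j)
    exact div_le_div_of_nonneg_left (by positivity) (by positivity) (pow_le_pow_right₀ (by norm_num) hle)
  -- Step 2: per-index bound `w_j f_j ≤ (2/τ) f_j Σ_{i<I, x_j < 2τ/4^i} 4^i`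
  have hper : ∀ j, w j * f j ≤
      (2 / τ) * (f j * ∑ i ∈ Finset.range I, if x j < 2 * τ / 4 ^ i then (4 : ℝ) ^ i else 0) := by
    intro j
    rcases (hx j).eq_or_lt with h0 | hpos
    · rw [hzero j h0.symm]
      simp
    · have hex : ∃ k, ¬ (x j < 2 * τ / 4 ^ k) := ⟨I, not_lt.mpr (hI j hpos).le⟩
      have hk_spec : ¬ (x j < 2 * τ / 4 ^ Nat.find hex) := Nat.find_spec hex
      have hk_min : ∀ i < Nat.find hex, x j < 2 * τ / 4 ^ i := fun i hi => by
        have := Nat.find_min hex hi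
        push Not at this
        exact this
      have hkI : Nat.find hex ≤ I := Nat.find_min' hex (not_lt.mpr (hI j hpos).le)
      have hk1 : 1 ≤ Nat.find hex := by
        rcases Nat.eq_zero_or_pos (Nat.find hex) with h | h
        · exfalso
          apply hk_spec
          rw [h, pow_zero, div_one]
          exact hxτ j
        · exact h
      set k := Nat.find hex with hk
      have hgeom : (4 : ℝ) ^ (k - 1) ≤ ∑ i ∈ Finset.range k, (4 : ℝ) ^ i := by
        have hmem : k - 1 ∈ Finset.range k := Finset.mem_range.mpr (by omega)
        exact Finset.single_le_sum (f := fun i => (4 : ℝ) ^ i) (fun i _ => by positivity) hmem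
      have hsub : ∑ i ∈ Finset.range k, (4 : ℝ) ^ i ≤
          ∑ i ∈ Finset.range I, (if x j < 2 * τ / 4 ^ i then (4 : ℝ) ^ i else 0) := by
        calc ∑ i ∈ Finset.range k, (4 : ℝ) ^ i
            = ∑ i ∈ Finset.range k, (if x j < 2 * τ / 4 ^ i then (4 : ℝ) ^ i else 0) :=
              Finset.sum_congr rfl fun i hi => by rw [if_pos (hk_min i (Finset.mem_range.mp hi))]
          _ ≤ ∑ i ∈ Finset.range I, (if x j < 2 * τ / 4 ^ i then (4 : ℝ) ^ i else 0) :=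
              Finset.sum_le_sum_of_subset_of_nonneg (Finset.range_mono hkI)
                (fun i _ _ => by split_ifs <;> positivity)
      have hw1 : w j ≤ 1 / x j := by
        rw [le_div_iff₀ hpos]
        exact hwx j
      have hx2 : 1 / x j ≤ (4 : ℝ) ^ k / (2 * τ) := by
        have hk_spec' : 2 * τ / 4 ^ k ≤ x j := not_lt.mp hk_spec
        rw [div_le_iff₀ (by positivity)] at hk_spec'
        rw [div_le_div_iff₀ hpos (by positivity), one_mul]
        linarith
      have h4k : (4 : ℝ) ^ k = 4 * 4 ^ (k - 1) := by
        conv_lhs => rw [show k = (k - 1) + 1 by omega, pow_succ]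
        ring
      calc w j * f j ≤ ((4 : ℝ) ^ k / (2 * τ)) * f j :=
            mul_le_mul_of_nonneg_right (hw1.trans hx2) (hf j)
        _ = (2 / τ) * (f j * 4 ^ (k - 1)) := by
            rw [h4k]
            field_simp
            ring
        _ ≤ (2 / τ) * (f j * ∑ i ∈ Finset.range I, (if x j < 2 * τ / 4 ^ i then (4 : ℝ) ^ i else 0)) := by
            apply mul_le_mul_of_nonneg_left _ (by positivity)
            exact mul_le_mul_of_nonneg_left (hgeom.trans hsub) (hf j)
  -- Step 3: sum over `j` and swap the sums
  have hsum : ∑ j, w j * f j ≤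
      (2 / τ) * ∑ i ∈ Finset.range I, (4 : ℝ) ^ i * ∑ j, (if x j < 2 * τ / 4 ^ i then f j else 0) := by
    calc ∑ j, w j * f j
        ≤ ∑ j, (2 / τ) * (f j * ∑ i ∈ Finset.range I, if x j < 2 * τ / 4 ^ i then (4 : ℝ) ^ i else 0) :=
          Finset.sum_le_sum fun j _ => hper j
      _ = (2 / τ) * ∑ j, ∑ i ∈ Finset.range I, (4 : ℝ) ^ i * (if x j < 2 * τ / 4 ^ i then f j else 0) := by
          rw [← Finset.mul_sum]
          congr 1
          refine Finset.sum_congr rfl fun j _ => ?_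
          rw [Finset.mul_sum]
          refine Finset.sum_congr rfl fun i _ => ?_
          split_ifs <;> ring
      _ = (2 / τ) * ∑ i ∈ Finset.range I, (4 : ℝ) ^ i * ∑ j, (if x j < 2 * τ / 4 ^ i then f j else 0) := by
          congr 1
          rw [Finset.sum_comm]
          exact Finset.sum_congr rfl fun i _ => by rw [Finset.mul_sum]
  -- Step 4: if every shell is light the swapped sum is `≤ 1/8`, contradiction
  have hgeo : ∑ i ∈ Finset.range I, (4 : ℝ) ^ i * ∑ j, (if x j < 2 * τ / 4 ^ i then f j else 0) ≤ 1 / 8 := by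
    calc ∑ i ∈ Finset.range I, (4 : ℝ) ^ i * ∑ j, (if x j < 2 * τ / 4 ^ i then f j else 0)
        ≤ ∑ i ∈ Finset.range I, (4 : ℝ) ^ i * (1 / (16 * 8 ^ i)) :=
          Finset.sum_le_sum fun i _ => mul_le_mul_of_nonneg_left (hcon i) (by positivity)
      _ = (1 / 16) * ∑ i ∈ Finset.range I, (1 / 2 : ℝ) ^ i := by
          rw [Finset.mul_sum]
          refine Finset.sum_congr rfl fun i _ => ?_
          have h8 : (8 : ℝ) ^ i = 4 ^ i * 2 ^ i := by
            rw [← mul_pow]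
            norm_num
          rw [h8, one_div_pow]
          field_simp
      _ ≤ (1 / 16) * 2 := by
          gcongr
          have h := geom_sum_Ico_le_of_lt_one (m := 0) (n := I) (x := (1 / 2 : ℝ)) (by norm_num) (by norm_num)
          rw [← Finset.range_eq_Ico, pow_zero] at h
          exact h.trans (by norm_num)
      _ = 1 / 8 := by norm_num
  have hτ' : (2 / τ) * (1 / 8) = 1 / (4 * τ) := by
    field_simp
    ring
  have := hsum.trans ((mul_le_mul_of_nonneg_left hgeo (by positivity)).trans hτ'.le)
  exact absurd (lt_of_lt_of_le hpile this) (lt_irrefl _)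

/-- **Dyadic shells of a pile-up family** (registered stub `dyadicShell_of_pileup` of crux stmt-QuantumFields-13901).
For any box `s`, level `τ > 0` and any family `u_j` with eigenvalue data `|ev_j| < 2τ`, weights `0 ≤ wgt_j`,
`wgt_j |ev_j| ≤ 1` (the shape shared by stubs 1, 4′, 5′ — orthonormality and the eigen-relation are not needed here)
whose sheet-weighted pile-up exceeds the A″/B″ threshold `1/(4τ)`: EITHER some member is an exact zero mode with
positive sheet fraction (`ev_j = 0`, `f_j > 0` — a crossing at the very valence mass, visible on the separator), OR some
shell is heavy — the sheet-weighted count of the members with `|ev_j| < 2τ/4^i` exceeds `1/(16·8^i)`.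
Proof: `dyadic_of_weighted_sum` with `x_j = |ev_j|`, marks `f_j` zeroed on the (weightless) zero modes. [folklore] -/
theorem dyadicShell_of_pileup :
    ∀ (N : ℕ) [NeZero N] (s : Fin 4 → ℕ) (τ : ℝ) (n : ℕ)
      (u : Fin n → ({p // wilsonBox (0 : TorusSite 4 N) s p} → ℂ)) (ev wgt : Fin n → ℝ), 0 < τ →
      (∀ j, |ev j| < 2 * τ ∧ 0 ≤ wgt j ∧ wgt j * |ev j| ≤ 1) →
      1 / (4 * τ) < ∑ j, wgt j * ∑ p, (if childrenInterior s p then (0 : ℝ) else ‖u j p‖ ^ 2) →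
      (∃ j, ev j = 0 ∧ 0 < ∑ p, (if childrenInterior s p then (0 : ℝ) else ‖u j p‖ ^ 2)) ∨
        ∃ i : ℕ, 1 / (16 * 8 ^ i) <
          ∑ j, if |ev j| < 2 * τ / 4 ^ i then ∑ p, (if childrenInterior s p then (0 : ℝ) else ‖u j p‖ ^ 2) else 0 := by
  intro N _ s τ n u ev wgt hτ hbd hpile
  classical
  by_cases hz : ∃ j, ev j = 0 ∧ 0 < ∑ p, (if childrenInterior s p then (0 : ℝ) else ‖u j p‖ ^ 2)
  · exact Or.inl hz
  · right
    push Not at hz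
    have hf0 : ∀ j, 0 ≤ ∑ p, (if childrenInterior s p then (0 : ℝ) else ‖u j p‖ ^ 2) :=
      fun j => Finset.sum_nonneg fun p _ => by split_ifs <;> positivity
    have hzero : ∀ j, |ev j| = 0 → ∑ p, (if childrenInterior s p then (0 : ℝ) else ‖u j p‖ ^ 2) = 0 :=
      fun j hj => le_antisymm (hz j (abs_eq_zero.mp hj)) (hf0 j)
    exact dyadic_of_weighted_sum (fun j => |ev j|) wgt
      (fun j => ∑ p, (if childrenInterior s p then (0 : ℝ) else ‖u j p‖ ^ 2)) τ hτ hf0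
      (fun j => abs_nonneg _) (fun j => (hbd j).1) (fun j => (hbd j).2.2) hzero hpile

end Summit.QuantumFields.QCD.Cruxes.CoerciveSea.ChiralityCollapsesPseudospectrum

end
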